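import Literature.MeasureTheory.Hausdorff.ConeVolumeGeneral
import Literature.MeasureTheory.Hausdorff.SphereArea
import HarnessLib

/-!
# The area of the round sphere in every dimension: `μHE[d] (S^d) = 2 π^{(d+1)/2} / Γ((d+1)/2)`

`SphereMeasure.lean` proves that on the unit sphere `S` of a `(d+1)`-dimensional real inner
product space the Euclidean (normalised) Hausdorff measure `μHE[d]` is a constant multiple
`κ = μHE[d] (S) / volume.toSphere S` of Mathlib's polar surface measure `volume.toSphere`
(Christensen's lemma), and `SphereArea.lean` evaluates `κ = 1` in dimension `3` only. This file
proves **`κ = 1` in every dimension `d ≥ 1`** by the same squeeze, run with the general cone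
volumes of `ConeVolumeGeneral.lean`:

* `le_euclideanHausdorffMeasure_cap_general`, `euclideanHausdorffMeasure_cap_le_general`: the cap
  `cap v c = {‖x‖ = 1, ⟪v, x⟫ > c}` projects `1`-Lipschitz onto the `d`-disc of radius
  `ρ = √(1 - c²)` of `vᗮ` and is a `(1 + ρ/c)`-Lipschitz graph over it, so
  `ω_d ρ^d ≤ μHE[d] (cap) ≤ (1 + ρ/c)^d ω_d ρ^d` (`ω_d` = volume of the unit `d`-ball);
* `volume.toSphere (cap) = (d+1) vol ((0,1) • cap) ∈ [ω_d ρ^d c, ω_d ρ^d / c^d]` (cones);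
* hence `c^d ≤ κ ≤ (1 + ρ/c)^d / c` for all `c ∈ (0,1)` (`pow_le_kappa_le_general`) and `κ = 1`
  (`euclideanHausdorffMeasure_unitSphere_eq_toSphere_general`).

Consequences: `toSphere_volume_univ_general` (`volume.toSphere S^d = 2 π^{(d+1)/2} / Γ((d+1)/2)`,
the classical area `|S^d|`), `euclideanHausdorffMeasure_unitSphere_general`,
`euclideanHausdorffMeasure_sphere_general` (`μHE[d] {‖x‖ = r} = r^d |S^d|`),
`comap_euclideanHausdorff_eq_toSphere_general` (`κ = 1` as measures),
`lintegral_sphere_euclideanHausdorff_general` (`∫⁻_{‖x‖ = r} f dμHE[d] = r^d ∫⁻ f (r ω) dτ(ω)`).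
This is the Hausdorff-measure input for Stone's values of the Colding–Minicozzi entropy of
spheres and cylinders (`Literature.Geometry.Riemannian.Stone1994_cylinderEntropy`).

## References

* H. Federer, *Geometric measure theory* (1969), 3.2.3, 3.2.13 (area formula; classical area of
  `S^d`; here avoided in favour of a direct squeeze).
* P. Mattila, *Geometry of sets and measures in Euclidean spaces* (1995), Thm. 3.4, §4.3.
-/

noncomputable section

open Set Metric Module Submodule Filter
open _root_.MeasureTheory _root_.MeasureTheory.Measure
open scoped ENNReal NNReal Topology RealInnerProductSpace Pointwise

namespace Literature.MeasureTheory.Hausdorff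

/-! ### Caps in every dimension -/

section Cap

/-- **Volume of a ball as a Hausdorff measure**: on a `d`-dimensional real inner product space
(`d ≥ 1`), `μHE[d] (B(x, R)) = R^d ω_d`, `ω_d = π^{d/2} / Γ(d/2 + 1)` (`μHE[d] = volume` there,
and Mathlib's `InnerProductSpace.volume_ball`). [folklore] -/
theorem euclideanHausdorffMeasure_ball_of_finrank {K : Type*} [NormedAddCommGroup K]
    [InnerProductSpace ℝ K] [FiniteDimensional ℝ K] [MeasurableSpace K] [BorelSpace K] {d : ℕ}
    (hK : finrank ℝ K = d) (hd : 0 < d) (x : K) (R : ℝ) :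
    (μHE[d] : Measure K) (ball x R) =
      ENNReal.ofReal R ^ d * ENNReal.ofReal (Real.sqrt Real.pi ^ d / Real.Gamma ((d : ℝ) / 2 + 1)) := by
  haveI : Nontrivial K := Module.nontrivial_of_finrank_pos (R := ℝ) (by omega)
  subst hK
  rw [InnerProductSpace.euclideanHausdorffMeasure_eq_volume, InnerProductSpace.volume_ball]

variable {E : Type*} [NormedAddCommGroup E] [InnerProductSpace ℝ E] [MeasurableSpace E]
  [BorelSpace E] {v : E}

/-- **Lower bound** (any dimension `d ≥ 1`): the cap of height `c` has `μHE[d]`-measure at least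
`ω_d ρ^d`, `ρ = √(1 - c²)`, the measure of the `d`-disc onto which it projects `1`-Lipschitz.
[folklore] -/
theorem le_euclideanHausdorffMeasure_cap_general (hv : ‖v‖ = 1) {d : ℕ}
    (hK : finrank ℝ (ℝ ∙ v)ᗮ = d) (hd : 0 < d) [FiniteDimensional ℝ (ℝ ∙ v)ᗮ] {c : ℝ}
    (hc0 : 0 < c) :
    ENNReal.ofReal (Real.sqrt (1 - c ^ 2)) ^ d *
        ENNReal.ofReal (Real.sqrt Real.pi ^ d / Real.Gamma ((d : ℝ) / 2 + 1)) ≤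
      (μHE[d] : Measure E) (cap v c) := by
  rw [← euclideanHausdorffMeasure_ball_of_finrank hK hd (0 : (ℝ ∙ v)ᗮ) (Real.sqrt (1 - c ^ 2))]
  have h2 := ((ℝ ∙ v)ᗮ.lipschitzWith_orthogonalProjectionOnto.lipschitzOnWith
    (s := cap v c)).euclideanHausdorffMeasure_image_le d
  rw [ENNReal.coe_one, one_pow, one_mul] at h2
  exact (measure_mono (ball_subset_image_cap hv hc0)).trans h2

/-- **Upper bound** (any dimension `d ≥ 1`): the cap of height `c ∈ (0,1)` has `μHE[d]`-measure
at most `(1 + ρ/c)^d ω_d ρ^d`, `ρ = √(1 - c²)` (Lipschitz graph over the disc). [folklore] -/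
theorem euclideanHausdorffMeasure_cap_le_general (hv : ‖v‖ = 1) {d : ℕ}
    (hK : finrank ℝ (ℝ ∙ v)ᗮ = d) (hd : 0 < d) [FiniteDimensional ℝ (ℝ ∙ v)ᗮ] {c : ℝ}
    (hc0 : 0 < c) (hc1 : c < 1) :
    (μHE[d] : Measure E) (cap v c) ≤
      ENNReal.ofReal ((1 + Real.sqrt (1 - c ^ 2) / c) ^ d) *
        (ENNReal.ofReal (Real.sqrt (1 - c ^ 2)) ^ d *
          ENNReal.ofReal (Real.sqrt Real.pi ^ d / Real.Gamma ((d : ℝ) / 2 + 1))) := by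
  set ρ := Real.sqrt (1 - c ^ 2) with hρ_def
  have hρ0 : 0 ≤ ρ := Real.sqrt_nonneg _
  have hρ1 : ρ < 1 := by rw [hρ_def, Real.sqrt_lt' one_pos]; nlinarith
  have hcρ : Real.sqrt (1 - ρ ^ 2) = c := by
    rw [hρ_def, Real.sq_sqrt (by nlinarith)]
    rw [show 1 - (1 - c ^ 2) = c ^ 2 by ring, Real.sqrt_sq hc0.le]
  rw [← euclideanHausdorffMeasure_ball_of_finrank hK hd (0 : (ℝ ∙ v)ᗮ) ρ]
  have h2 := (lipschitzOnWith_capLift hv hρ0 hρ1).euclideanHausdorffMeasure_image_le d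
  rw [hcρ] at h2
  refine (measure_mono (cap_subset_image_capLift hv hc0)).trans (h2.trans ?_)
  gcongr
  apply le_of_eq
  rw [ENNReal.ofReal_pow (by positivity)]
  rfl

end Cap

/-! ### The squeeze and `κ = 1` in every dimension -/

section Main

variable {E : Type*} [NormedAddCommGroup E] [InnerProductSpace ℝ E] [FiniteDimensional ℝ E]
  [MeasurableSpace E] [BorelSpace E]

/-- The proportionality `σ = κ • τ` of `SphereMeasure.lean` evaluated on a cap, dimension
`d + 1`: `μHE[d] (cap v c) = κ · (d+1) · vol ((0,1) • cap v c)`. [folklore] -/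
theorem euclideanHausdorffMeasure_cap_eq_general {d : ℕ} (hE : finrank ℝ E = d + 1) (v : E)
    (c : ℝ) :
    (μHE[d] : Measure E) (cap v c) =
      ((μHE[d] : Measure E) (sphere 0 1) / (volume : Measure E).toSphere univ) *
        ((d + 1 : ℕ) * volume (Ioo (0 : ℝ) 1 • cap v c)) := by
  have h := comap_euclideanHausdorff_eq_smul_toSphere (E := E) (d := d) hE
  have hme := MeasurableEmbedding.subtype_coe
    ((isClosed_sphere : IsClosed (sphere (0 : E) 1)).measurableSet)
  have hC := measurableSet_capSub v c
  have h1 := congrArg (fun μ : Measure (sphere (0 : E) 1) ↦ μ {ω | c < ⟪v, (ω : E)⟫}) h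
  simp only [Measure.smul_apply, smul_eq_mul] at h1
  rw [hme.comap_apply, image_val_capSub, Measure.toSphere_apply' _ hC, image_val_capSub, hE] at h1
  exact h1

/-- **The squeeze in dimension `d + 1`** (`d ≥ 1`): the constant
`κ = μHE[d] (S^d) / volume.toSphere S^d` satisfies `c^d ≤ κ ≤ (1 + √(1 - c²)/c)^d / c` for every
`0 < c < 1`. [folklore] -/
theorem pow_le_kappa_le_general {d : ℕ} (hE : finrank ℝ E = d + 1) (hd : 0 < d) {c : ℝ}
    (hc0 : 0 < c) (hc1 : c < 1) :
    c ^ d ≤ ((μHE[d] : Measure E) (sphere 0 1) / (volume : Measure E).toSphere univ).toReal ∧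
    ((μHE[d] : Measure E) (sphere 0 1) / (volume : Measure E).toSphere univ).toReal ≤
      (1 + Real.sqrt (1 - c ^ 2) / c) ^ d / c := by
  set b : OrthonormalBasis (Fin (d + 1)) ℝ E := (stdOrthonormalBasis ℝ E).reindex (finCongr hE)
  set v : E := b 0 with hv_def
  have hv : ‖v‖ = 1 := b.orthonormal.1 0
  haveI : Fact (finrank ℝ E = d + 1) := ⟨hE⟩
  have hv0 : v ≠ 0 := by
    intro h; rw [h, norm_zero] at hv; exact zero_ne_one hv
  have hK : finrank ℝ (ℝ ∙ v)ᗮ = d := Submodule.finrank_orthogonal_span_singleton hv0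
  set κ := (μHE[d] : Measure E) (sphere 0 1) / (volume : Measure E).toSphere univ with hκ_def
  have hκ : κ ≠ ⊤ := euclideanHausdorff_div_toSphere_ne_top hE
  -- the constants
  set C : ℝ := Real.sqrt Real.pi ^ d / Real.Gamma ((d : ℝ) / 2 + 1) with hC_def
  have hd' : (0 : ℝ) < (d : ℝ) / 2 + 1 := by
    have := Nat.cast_nonneg (α := ℝ) d
    linarith
  have hC : 0 < C := div_pos (pow_pos (Real.sqrt_pos.2 Real.pi_pos) _) (Real.Gamma_pos_of_pos hd')
  set ρ : ℝ := Real.sqrt (1 - c ^ 2) with hρ_def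
  have hρ : 0 < ρ := Real.sqrt_pos.2 (by nlinarith)
  have hρd : 0 < ρ ^ d := pow_pos hρ d
  have hcd : 0 < c ^ d := pow_pos hc0 d
  have htd : (ρ / c) ^ d * c ^ d = ρ ^ d := by
    rw [div_pow, div_mul_cancel₀ _ hcd.ne']
  have hd1 : (0 : ℝ) < (d : ℝ) + 1 := by positivity
  -- the sector volume `V` and its two-sided bounds, as real numbers
  set V := volume (Ioo (0 : ℝ) 1 • cap v c) with hV_def
  have hV_le' := volume_Ioo_smul_cap_le_general hd b hc0 hc1
  have hle_V' := le_volume_Ioo_smul_cap_general hd b hc0 hc1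
  rw [← hv_def, ← hV_def, ← hC_def, ← hρ_def] at hV_le' hle_V'
  have hVtop : V ≠ ⊤ := ne_top_of_le_ne_top ENNReal.ofReal_ne_top hV_le'
  have hV_le : V.toReal ≤ C * (ρ / c) ^ d / (d + 1) := by
    have := ENNReal.toReal_mono ENNReal.ofReal_ne_top hV_le'
    rwa [ENNReal.toReal_ofReal (by positivity)] at this
  have hle_V : C * (ρ / c) ^ d * c ^ (d + 1) / (d + 1) ≤ V.toReal := by
    have := ENNReal.toReal_mono hVtop hle_V'
    rwa [ENNReal.toReal_ofReal (by positivity)] at this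
  -- the cap measure `σ (cap)` and its two-sided bounds, as real numbers
  have heq := euclideanHausdorffMeasure_cap_eq_general hE v c
  rw [← hκ_def, ← hV_def] at heq
  have hσ_eq : ((μHE[d] : Measure E) (cap v c)).toReal = κ.toReal * ((d + 1) * V.toReal) := by
    rw [heq, ENNReal.toReal_mul, ENNReal.toReal_mul, ENNReal.toReal_natCast]
    push_cast
    ring
  have hσtop : (μHE[d] : Measure E) (cap v c) ≠ ⊤ := by
    rw [heq]
    exact ENNReal.mul_ne_top hκ (ENNReal.mul_ne_top (ENNReal.natCast_ne_top _) hVtop)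
  have hle_σ' := le_euclideanHausdorffMeasure_cap_general hv hK hd hc0 (E := E)
  have hσ_le' := euclideanHausdorffMeasure_cap_le_general hv hK hd hc0 hc1 (E := E)
  rw [← hρ_def, ← hC_def, ← ENNReal.ofReal_pow hρ.le, ← ENNReal.ofReal_mul hρd.le] at hle_σ' hσ_le'
  rw [← ENNReal.ofReal_mul (by positivity)] at hσ_le'
  have hle_σ : ρ ^ d * C ≤ ((μHE[d] : Measure E) (cap v c)).toReal := by
    have := ENNReal.toReal_mono hσtop hle_σ'
    rwa [ENNReal.toReal_ofReal (by positivity)] at this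
  have hσ_le : ((μHE[d] : Measure E) (cap v c)).toReal ≤ (1 + ρ / c) ^ d * (ρ ^ d * C) := by
    have := ENNReal.toReal_mono ENNReal.ofReal_ne_top hσ_le'
    rwa [ENNReal.toReal_ofReal (by positivity)] at this
  rw [hσ_eq] at hle_σ hσ_le
  have hκ0 : 0 ≤ κ.toReal := ENNReal.toReal_nonneg
  constructor
  · -- `ρ^d C ≤ κ (d+1) V ≤ κ C (ρ/c)^d`, so `c^d ≤ κ`
    have h1 : ρ ^ d * C ≤ κ.toReal * (C * (ρ / c) ^ d) := by
      refine hle_σ.trans ?_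
      have : (d + 1) * V.toReal ≤ C * (ρ / c) ^ d := by
        rw [← le_div_iff₀' hd1]
        exact hV_le
      exact mul_le_mul_of_nonneg_left this hκ0
    have h2 : c ^ d * (ρ ^ d * C) ≤ κ.toReal * (ρ ^ d * C) := by
      calc c ^ d * (ρ ^ d * C) ≤ c ^ d * (κ.toReal * (C * (ρ / c) ^ d)) :=
            mul_le_mul_of_nonneg_left h1 hcd.le
        _ = κ.toReal * (ρ ^ d * C) := by rw [← htd]; ring
    exact le_of_mul_le_mul_right h2 (by positivity)
  · -- `κ (d+1) (C (ρ/c)^d c^{d+1}/(d+1)) ≤ κ (d+1) V ≤ (1 + ρ/c)^d ρ^d C`, so `κ ≤ (1+ρ/c)^d / c`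
    have h1 : κ.toReal * (C * (ρ / c) ^ d * c ^ (d + 1)) ≤ (1 + ρ / c) ^ d * (ρ ^ d * C) := by
      refine le_trans ?_ hσ_le
      have : C * (ρ / c) ^ d * c ^ (d + 1) ≤ (d + 1) * V.toReal := by
        rw [← div_le_iff₀' hd1]
        exact hle_V
      exact mul_le_mul_of_nonneg_left this hκ0
    have h2 : κ.toReal * c * (ρ ^ d * C) ≤ (1 + ρ / c) ^ d * (ρ ^ d * C) := by
      calc κ.toReal * c * (ρ ^ d * C) = κ.toReal * (C * (ρ / c) ^ d * c ^ (d + 1)) := by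
            rw [← htd]; ring
        _ ≤ (1 + ρ / c) ^ d * (ρ ^ d * C) := h1
    rw [le_div_iff₀ hc0]
    exact le_of_mul_le_mul_right h2 (by positivity)

/-- **`κ = 1` in every dimension**: for a real inner product space of dimension `d + 1`
(`d ≥ 1`), the Euclidean Hausdorff measure `μHE[d]` of the unit sphere equals its polar surface
measure `volume.toSphere univ` (squeeze `c → 1⁻` in `pow_le_kappa_le_general`). This is
Federer's `H^d⌊S^d = σ` (1969, 3.2.13 with 3.2.3) proved without the area formula. [folklore] -/
theorem euclideanHausdorffMeasure_unitSphere_eq_toSphere_general {d : ℕ}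
    (hE : finrank ℝ E = d + 1) (hd : 0 < d) :
    (μHE[d] : Measure E) (sphere 0 1) = (volume : Measure E).toSphere univ := by
  set κ := (μHE[d] : Measure E) (sphere 0 1) / (volume : Measure E).toSphere univ with hκ_def
  have hκ : κ ≠ ⊤ := euclideanHausdorff_div_toSphere_ne_top hE
  have hev : ∀ᶠ c in 𝓝[<] (1 : ℝ), c ^ d ≤ κ.toReal ∧
      κ.toReal ≤ (1 + Real.sqrt (1 - c ^ 2) / c) ^ d / c := by
    filter_upwards [Ioo_mem_nhdsLT one_pos] with c hc
    exact pow_le_kappa_le_general hE hd hc.1 hc.2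
  have hlow : Tendsto (fun c : ℝ ↦ c ^ d) (𝓝[<] (1 : ℝ)) (𝓝 1) := by
    have : Tendsto (fun c : ℝ ↦ c ^ d) (𝓝 (1 : ℝ)) (𝓝 (1 ^ d)) :=
      (continuous_pow d).continuousAt.tendsto
    rw [one_pow] at this
    exact this.mono_left nhdsWithin_le_nhds
  have hup : Tendsto (fun c : ℝ ↦ (1 + Real.sqrt (1 - c ^ 2) / c) ^ d / c) (𝓝[<] (1 : ℝ))
      (𝓝 1) := by
    have hcont : ContinuousAt (fun c : ℝ ↦ (1 + Real.sqrt (1 - c ^ 2) / c) ^ d / c) 1 := by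
      fun_prop (disch := norm_num)
    have := hcont.tendsto
    simp only [one_pow, sub_self, Real.sqrt_zero, add_zero, div_one] at this
    exact this.mono_left nhdsWithin_le_nhds
  have h1 : 1 ≤ κ.toReal := le_of_tendsto hlow (hev.mono fun c hc ↦ hc.1)
  have h2 : κ.toReal ≤ 1 := ge_of_tendsto hup (hev.mono fun c hc ↦ hc.2)
  have hk : κ = 1 := by
    rw [← ENNReal.ofReal_toReal hκ, le_antisymm h2 h1, ENNReal.ofReal_one]
  have hnt : Nontrivial E := Module.nontrivial_of_finrank_pos (R := ℝ) (by omega)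
  have hτ0 : (volume : Measure E).toSphere univ ≠ 0 := by
    rw [Ne, measure_univ_eq_zero]
    exact Measure.toSphere_ne_zero _
  rw [hκ_def, ENNReal.div_eq_one_iff hτ0 (measure_ne_top _ _)] at hk
  exact hk

/-- **The classical area of `S^d`** for the polar surface measure:
`volume.toSphere S^d = (d+1) vol (B^{d+1}) = 2 π^{(d+1)/2} / Γ((d+1)/2)`. [folklore] -/
theorem toSphere_volume_univ_general {d : ℕ} (hE : finrank ℝ E = d + 1) :
    (volume : Measure E).toSphere univ =
      ENNReal.ofReal (2 * Real.pi ^ (((d : ℝ) + 1) / 2) / Real.Gamma (((d : ℝ) + 1) / 2)) := by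
  have hnt : Nontrivial E := Module.nontrivial_of_finrank_pos (R := ℝ) (by omega)
  have hq : (0 : ℝ) < ((d : ℝ) + 1) / 2 := by positivity
  rw [Measure.toSphere_apply_univ, InnerProductSpace.volume_ball (0 : E) 1, hE,
    ENNReal.ofReal_one, one_pow, one_mul, ← ENNReal.ofReal_natCast,
    ← ENNReal.ofReal_mul (Nat.cast_nonneg _)]
  congr 1
  have hΓ : Real.Gamma (((d + 1 : ℕ) : ℝ) / 2 + 1) =
      ((d : ℝ) + 1) / 2 * Real.Gamma (((d : ℝ) + 1) / 2) := by
    push_cast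
    rw [Real.Gamma_add_one hq.ne']
  have hpow : Real.sqrt Real.pi ^ (d + 1) = Real.pi ^ (((d : ℝ) + 1) / 2) := by
    rw [Real.sqrt_eq_rpow, ← Real.rpow_natCast, ← Real.rpow_mul Real.pi_pos.le]
    push_cast
    ring_nf
  rw [hΓ, hpow]
  have hΓ0 : Real.Gamma (((d : ℝ) + 1) / 2) ≠ 0 := (Real.Gamma_pos_of_pos hq).ne'
  push_cast
  field_simp

/-- **The area of the unit `d`-sphere for the Hausdorff measure**:
`μHE[d] (S^d) = 2 π^{(d+1)/2} / Γ((d+1)/2)` in a `(d+1)`-dimensional real inner product space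
(`d ≥ 1`). Federer 1969, 3.2.13. [folklore] -/
theorem euclideanHausdorffMeasure_unitSphere_general {d : ℕ} (hE : finrank ℝ E = d + 1)
    (hd : 0 < d) :
    (μHE[d] : Measure E) (sphere 0 1) =
      ENNReal.ofReal (2 * Real.pi ^ (((d : ℝ) + 1) / 2) / Real.Gamma (((d : ℝ) + 1) / 2)) := by
  rw [euclideanHausdorffMeasure_unitSphere_eq_toSphere_general hE hd, toSphere_volume_univ_general hE]

/-- **The area of a round `d`-sphere of radius `r`**: `μHE[d] {‖x‖ = r} = r^d |S^d|` (`r > 0`,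
`d ≥ 1`). [folklore] -/
theorem euclideanHausdorffMeasure_sphere_general {d : ℕ} (hE : finrank ℝ E = d + 1) (hd : 0 < d)
    {r : ℝ} (hr : 0 < r) :
    (μHE[d] : Measure E) (sphere 0 r) =
      ENNReal.ofReal (r ^ d * (2 * Real.pi ^ (((d : ℝ) + 1) / 2) / Real.Gamma (((d : ℝ) + 1) / 2))) := by
  have hq : (0 : ℝ) < ((d : ℝ) + 1) / 2 := by positivity
  rw [← smul_unitSphere hr, Measure.euclideanHausdorffMeasure_smul₀ d hr.ne',
    euclideanHausdorffMeasure_unitSphere_general hE hd, ENNReal.smul_def, smul_eq_mul,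
    ENNReal.coe_pow, ← ENNReal.ofReal_coe_nnreal, coe_nnnorm, Real.norm_eq_abs, abs_of_pos hr,
    ← ENNReal.ofReal_pow hr.le, ← ENNReal.ofReal_mul (by positivity)]

/-- The unit sphere has positive `μHE[d]`-measure (`d ≥ 1`). [folklore] -/
theorem euclideanHausdorffMeasure_unitSphere_pos {d : ℕ} (hE : finrank ℝ E = d + 1) (hd : 0 < d) :
    0 < (μHE[d] : Measure E) (sphere 0 1) := by
  have hnt : Nontrivial E := Module.nontrivial_of_finrank_pos (R := ℝ) (by omega)
  rw [euclideanHausdorffMeasure_unitSphere_eq_toSphere_general hE hd, pos_iff_ne_zero, Ne,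
    measure_univ_eq_zero]
  exact Measure.toSphere_ne_zero _

/-- **`κ = 1` as measures, every dimension**: on the unit sphere of a `(d+1)`-dimensional real
inner product space (`d ≥ 1`) the Euclidean Hausdorff measure `μHE[d]` *is* the polar surface
measure `volume.toSphere`. [folklore] -/
theorem comap_euclideanHausdorff_eq_toSphere_general {d : ℕ} (hE : finrank ℝ E = d + 1)
    (hd : 0 < d) :
    (μHE[d] : Measure E).comap (Subtype.val : sphere (0 : E) 1 → E) =
      (volume : Measure E).toSphere := by
  have hnt : Nontrivial E := Module.nontrivial_of_finrank_pos (R := ℝ) (by omega)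
  have hτ0 : (volume : Measure E).toSphere univ ≠ 0 := by
    rw [Ne, measure_univ_eq_zero]
    exact Measure.toSphere_ne_zero _
  rw [comap_euclideanHausdorff_eq_smul_toSphere (d := d) hE,
    euclideanHausdorffMeasure_unitSphere_eq_toSphere_general hE hd,
    ENNReal.div_self hτ0 (measure_ne_top _ _), one_smul]

/-- **The Hausdorff measure of a round sphere in polar form**: for `r > 0` and `d ≥ 1`, the
restriction of `μHE[d]` to `{‖x‖ = r}` is `r^d` times the image of `volume.toSphere` under
`ω ↦ r ω`. [folklore] -/
theorem euclideanHausdorff_restrict_sphere_eq_map_toSphere {d : ℕ} (hE : finrank ℝ E = d + 1)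
    (hd : 0 < d) {r : ℝ} (hr : 0 < r) :
    (μHE[d] : Measure E).restrict (sphere (0 : E) r) =
      ENNReal.ofReal (r ^ d) • Measure.map (fun ω : sphere (0 : E) 1 ↦ r • (ω : E))
        ((volume : Measure E).toSphere) := by
  rw [euclideanHausdorff_restrict_sphere_eq_map d hr, comap_euclideanHausdorff_eq_toSphere_general hE hd]
  congr 1
  rw [ENNReal.coe_pow, ← ENNReal.ofReal_coe_nnreal, coe_nnnorm, Real.norm_eq_abs, abs_of_pos hr,
    ENNReal.ofReal_pow hr.le]

/-- **Sphere integrals against the Hausdorff measure, polar form** (`ℝ≥0∞`-valued): for `r > 0`,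
`d ≥ 1` and measurable `f`, `∫⁻_{‖x‖ = r} f dμHE[d] = r^d ∫⁻ f (r ω) d(volume.toSphere)(ω)`.
[folklore] -/
theorem lintegral_sphere_euclideanHausdorff_general {d : ℕ} (hE : finrank ℝ E = d + 1)
    (hd : 0 < d) {r : ℝ} (hr : 0 < r) {f : E → ℝ≥0∞} (hf : Measurable f) :
    ∫⁻ x in sphere (0 : E) r, f x ∂(μHE[d] : Measure E) =
      ENNReal.ofReal (r ^ d) * ∫⁻ ω : sphere (0 : E) 1, f (r • (ω : E)) ∂(volume : Measure E).toSphere := by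
  have hg : Measurable fun ω : sphere (0 : E) 1 ↦ r • (ω : E) :=
    (continuous_const.smul continuous_subtype_val).measurable
  rw [euclideanHausdorff_restrict_sphere_eq_map_toSphere hE hd hr, lintegral_smul_measure,
    lintegral_map hf hg, smul_eq_mul]

end Main

end Literature.MeasureTheory.Hausdorff

end
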